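import Summits.PneNP.PneNP.Theses.ArnoldMorseDeficit
import Literature.Computability.Complexity.TFNPProblems

/-!
# Route ArnoldMorseDeficit — the deciding crux `MorseDeficitHard` DERIVED from its two pieces
# (stmt-PneNP-11725; BC2 redirect `MorseDeficitHard ⟸ EoplToMorseDeficit ∧ EoplHard`)

`MorseDeficitHard` ("no `g ∈ FP` solves MORSE-DEFICIT") is at least as strong as the summit. Its
honest typed decomposition is the TFNP-hardness pattern the route's thesis declares
("X ⟸ CLS ⊄ FP", crux 2):

* `EoplToMorseDeficit` (stmt-PneNP-11726, the route's rank-2 crux, PROVABLE-IN-PRINCIPLE content):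
  END-OF-POTENTIAL-LINE Karp-reduces to MORSE-DEFICIT, stated over the route's own string coding
  `⟨1ᵏ, ⟨encList S, ⟨encList P, encList V⟩⟩⟩` of an EOPL instance;
* `EoplHard` (stmt-PneNP-18975, new piece): END-OF-POTENTIAL-LINE is not solvable in polynomial time,
  `¬ TFNP.EndOfPotentialLine.SolvableInFP` over the Literature vocabulary
  (`TotalSearchProblem.lean`, `TFNPProblems.lean`; `EOPL = CLS = PPAD ∩ PLS`).

The assembly below is the transfer of hardness along the reduction.  It is not a one-line seam:
the Literature problem `TFNP.EndOfPotentialLine` codes instances as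
`TFNP.instCode k [S, P, V] = ⟨1ᵏ, encList [encList S, encList P, encList V]⟩`, evaluates circuits by
`TFNP.evalBits` and reads potentials by `bitsToNat`, whereas the route's crux inlines its own
coding, its own evaluator `EB` and its own little-endian value `toNat`; the proof builds the
polynomial-time RE-CODER between the two instance codes (pair projections and fan-outs), shows the
two evaluators and the two numeral readings agree, derives `1 ≤ k` from the END-OF-LINE side
condition, and composes `ψ ∘ ⟨recode, g ∘ φ ∘ recode⟩ ∈ FP` into a solver of END-OF-POTENTIAL-LINE.
-/

set_option linter.dupNamespace false -- `Summit.PneNP.PneNP.…`: summit = sub-problem name (D-0017 single-conjunct layout)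

namespace Summit.PneNP.PneNP.Theorems

open Literature.Computability.Complexity Computability

/-- Little-endian reading of the table of a Boolean function on `Fin n`: `Σ_j [f j] 2^j = bitsToNat (ofFn f)`.
[Arora–Barak 2009, §0.1 (binary representation)] [folklore] -/
theorem morse_sum_finRange_ite_eq_bitsToNat_ofFn (n : ℕ) (f : Fin n → Bool) :
    ((List.finRange n).map fun j => if f j then 2 ^ (j : ℕ) else 0).sum = bitsToNat (List.ofFn f) := by
  induction n with
  | zero => simp
  | succ n ih =>
    rw [List.finRange_succ, List.map_cons, List.map_map, List.sum_cons, List.ofFn_succ, bitsToNat_cons,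
      ← ih (fun i => f i.succ)]
    have h0 : (if f 0 then 2 ^ ((0 : Fin (n + 1)) : ℕ) else 0) = (f 0).toNat := by
      cases f 0 <;> simp
    have h1 : ((fun j : Fin (n + 1) => if f j then 2 ^ (j : ℕ) else 0) ∘ Fin.succ) =
        fun j : Fin n => 2 * (if f j.succ then 2 ^ (j : ℕ) else 0) := by
      funext j
      simp only [Function.comp_apply, Fin.val_succ, pow_succ]
      split <;> ring
    rw [h0, h1, List.sum_map_mul_left]

/-- The route's inline little-endian reading `Σ_j [w_j] 2^j` of a bit string is `bitsToNat`.
[Arora–Barak 2009, §0.1 (binary representation)] [folklore] -/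
theorem morse_sum_finRange_eq_bitsToNat (w : List Bool) :
    ((List.finRange w.length).map fun j => if w.get j then 2 ^ (j : ℕ) else 0).sum = bitsToNat w := by
  have h := morse_sum_finRange_ite_eq_bitsToNat_ofFn w.length w.get
  rwa [List.ofFn_get] at h

/-- The route's inline circuit evaluator `EB C w = C.map (fun d => decide (evalFn ⟨w, d⟩ = [true]))`
is the Literature's `TFNP.evalBits C w`. [folklore] -/
theorem morse_map_decide_eq_evalBits (C : List (List Bool)) (w : List Bool) :
    (C.map fun d => decide (CircEval.evalFn (boolPair w d) = [true])) = TFNP.evalBits C w := by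
  unfold TFNP.evalBits
  refine List.map_congr_left fun d _ => ?_
  rw [TFNP.evalBit_eq_decide]

/-- A polynomial-time RE-CODER from the Literature's instance code
`TFNP.instCode k [S, P, V] = ⟨1ᵏ, ⟨encList S, ⟨encList P, ⟨encList V, []⟩⟩⟩⟩` to the route's code
`⟨1ᵏ, ⟨encList S, ⟨encList P, encList V⟩⟩⟩` (pair projections and fan-outs, all in `FP`).
[Arora–Barak 2009, Thm. 2.8 (proof: composition)] [folklore] -/
theorem exists_eopl_recode_mem_FP :
    ∃ r : List Bool → List Bool, r ∈ FP ∧ ∀ (k : ℕ) (S P V : List (List Bool)),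
      r (TFNP.instCode k [S, P, V]) =
        boolPair (unaryEncodeNat k) (boolPair (encList S) (boolPair (encList P) (encList V))) := by
  refine ⟨fanoutFn (fun z => (boolUnpair z).1)
      (fanoutFn ((fun z => (boolUnpair z).1) ∘ (fun z => (boolUnpair z).2))
        (fanoutFn ((fun z => (boolUnpair z).1) ∘ (fun z => (boolUnpair z).2) ∘ (fun z => (boolUnpair z).2))
          ((fun z => (boolUnpair z).1) ∘ (fun z => (boolUnpair z).2) ∘ (fun z => (boolUnpair z).2) ∘
            (fun z => (boolUnpair z).2)))), ?_, ?_⟩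
  · exact fanoutFn_mem_FP boolUnpairFst_mem_FP
      (fanoutFn_mem_FP (comp_mem_FP boolUnpairFst_mem_FP boolUnpairSnd_mem_FP)
        (fanoutFn_mem_FP
          (comp_mem_FP boolUnpairFst_mem_FP (comp_mem_FP boolUnpairSnd_mem_FP boolUnpairSnd_mem_FP))
          (comp_mem_FP boolUnpairFst_mem_FP (comp_mem_FP boolUnpairSnd_mem_FP
            (comp_mem_FP boolUnpairSnd_mem_FP boolUnpairSnd_mem_FP)))))
  · intro k S P V
    simp [TFNP.instCode, fanoutFn_apply, Function.comp_apply, boolUnpair_boolPair, encList_cons]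

/-- **`MorseDeficitHard` from its pieces** (BC2 redirect of the deciding crux stmt-PneNP-11725):
if END-OF-POTENTIAL-LINE Karp-reduces to MORSE-DEFICIT (`EoplToMorseDeficit`, stmt-PneNP-11726) and
END-OF-POTENTIAL-LINE is not solvable in polynomial time (`¬ TFNP.EndOfPotentialLine.SolvableInFP`,
i.e. `EOPL = CLS ⊄ FP`), then no polynomial-time function solves MORSE-DEFICIT.  Hardness transfer
along a many-one reduction (Papadimitriou 1994, §2, Prop. 1; FGHS 2022, §3.1.1), across the two codings.
[cite: Papadimitriou1994Parity, §2 (Prop. 1)] [cite: FearnleyGordonMehtaSavani2020, Def. 9] -/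
theorem morseDeficitHard_of_subs :
    Summit.PneNP.PneNP.Theses.ArnoldMorseDeficit.EoplToMorseDeficit →
    ¬ TFNP.EndOfPotentialLine.SolvableInFP →
    Summit.PneNP.PneNP.Theses.ArnoldMorseDeficit.MorseDeficitHard := by
  unfold Summit.PneNP.PneNP.Theses.ArnoldMorseDeficit.EoplToMorseDeficit
    Summit.PneNP.PneNP.Theses.ArnoldMorseDeficit.MorseDeficitHard
  intro hred hE
  dsimp only at hred ⊢
  rintro ⟨g, hg, hsolve⟩
  obtain ⟨φ, hφ, ψ, hψ, hR⟩ := hred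
  obtain ⟨r, hr, hrcode⟩ := exists_eopl_recode_mem_FP
  apply hE
  unfold TFNP.EndOfPotentialLine
  rw [TFNP.ofCircuits_solvableInFP_iff]
  refine ⟨ψ ∘ fanoutFn r (g ∘ φ ∘ r),
    comp_mem_FP hψ (fanoutFn_mem_FP hr (comp_mem_FP hg (comp_mem_FP hφ hr))), ?_⟩
  intro n Cs hV
  match Cs, hV with
  | [S, P, V], hV =>
    obtain ⟨hS, hP, hP0, hS0, -⟩ := hV
    -- the END-OF-LINE side condition `S(0ⁿ) ≠ 0ⁿ` forces `n ≥ 1`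
    have hn : 1 ≤ n := by
      rcases Nat.eq_zero_or_pos n with rfl | h
      · exfalso
        obtain rfl : S = [] := List.eq_nil_of_length_eq_zero hS
        exact hS0 rfl
      · exact h
    -- the side conditions in the route's rendering
    have hP0' : (P.map fun d => decide (CircEval.evalFn (boolPair (List.replicate n false) d) = [true])) =
        List.replicate n false := by
      rw [morse_map_decide_eq_evalBits]; exact hP0
    have hS0' : (S.map fun d => decide (CircEval.evalFn (boolPair (List.replicate n false) d) = [true])) ≠
        List.replicate n false := by
      rw [morse_map_decide_eq_evalBits]; exact hS0
    obtain ⟨I, hI, hVI, hback⟩ := hR n S P V hn hS hP hP0' hS0'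
    obtain ⟨c, hc, hcs⟩ := hsolve I hVI
    have hsolE := hback c hcs
    have hgc : (ψ ∘ fanoutFn r (g ∘ φ ∘ r)) (TFNP.instCode n [S, P, V]) =
        ψ (boolPair (boolPair (unaryEncodeNat n) (boolPair (encList S) (boolPair (encList P) (encList V))))
          ((List.ofFn fun i : Fin I.1 => List.ofFn fun j : Fin I.2.1 => (c.1 i).testBit j).flatten ++
            List.ofFn c.2)) := by
      simp only [Function.comp_apply, fanoutFn_apply, hrcode, ← hI, hc]
    rw [hgc]
    simp only [morse_map_decide_eq_evalBits, morse_sum_finRange_eq_bitsToNat] at hsolE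
    simp only [TFNP.EndOfPotentialLine.IsSolution]
    exact hsolE

/-- **The glue item `MorseDeficitHardOfEopl` of route ArnoldMorseDeficit (stmt-PneNP-18998) holds**:
`EoplToMorseDeficit → EoplHard → MorseDeficitHard`, by `morseDeficitHard_of_subs` (the item's `EoplHard` is
`¬ TFNP.EndOfPotentialLine.SolvableInFP` by definition). [cite: Papadimitriou1994Parity, §2 (Prop. 1)] -/
theorem morseDeficitHardOfEopl_proof :
    Summit.PneNP.PneNP.Theses.ArnoldMorseDeficit.MorseDeficitHardOfEopl :=
  fun hR hE => morseDeficitHard_of_subs hR hE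

end Summit.PneNP.PneNP.Theorems
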